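import Summits.HodgeConjecture.HodgeConjecture.Theorems.Ring2WeilCoverageCMFieldAllPrimesP
import HarnessLib

/-!
# Weil-type components over quartic CM fields, IX (part Q): peeling a prime of `ℤ[σ]` off a norm from
# `ℤ[η] = ℤ[σ][√σ]` — the two descent steps for the split side of the `D₄` table, model-free

research route conditional on HC_CM; not a corollary; Q11.4-sentence-2 already refuted in dim ≥ 3. Cell
`pub-hodge-ring2`, seat `ring2-b03` (gen 53); `HOME/WEIL-FAMILY-COVERAGE.md` §b03.5, seventh table
(`E = ℚ(√-(3+√2)) = F(η)`, `η² = σ = -3-√2`, `F = ℚ(√2)`, `R = S² + 6S + 7`). Integer coordinates as in part P: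
`z = x + yη ∈ ℤ[η]` with `x = A + Bσ`, `y = C + Dσ`; its norm `Nm(z) = x² - σy² ∈ ℤ[σ]` has coordinates
`X = A² - 7B² + 14CD - 42D²`, `Y = 2AB - 6B² - C² + 12CD - 29D²` (`normForm_coords` with `p = 6`, `q = 7`).
The descent of parts R/S proves, for a prime element `θ` of `ℤ[σ]` split in `E`, that `θ·μ = Nm(z)` for some
integral `z` and a totally positive `μ` of 2-power norm, by peeling the odd primes of `μ` one at a time. This file
supplies the two peeling steps for a prime element `θ' = u' + v'σ` given abstractly by EUCLID'S LEMMA (`heuclid`;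
suppliers: part P `degOne_euclid` for degree-one primes, `inertRat_euclid` below for inert rational primes):

* §1 the coordinate identities: Brahmagupta composition `Nm(z·w̄) = Nm(z)·Nm(w)` with
  `z·w̄ = (xa - σyb) + (ya - xb)η` (and `z·w`), the product `(ya - xb)(ya + xb) = y²·Nm(w) - b²·Nm(z)`,
  `(xa ∓ σyb)² = Nm(z)Nm(w) + σ(ya ∓ xb)²`, and `Nm(θz) = θ²·Nm(z)`;
* §2 **`split_peel`**: if `Nm(z) = π·θ'·μ''` and `Nm(w) = θ'·μ_w` (an INTEGRAL norm witness for the split-type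
  prime `θ'`), then `Nm(z₁) = π·(μ''·μ_w)` for an explicit integral `z₁ = (z·w̄)/θ'` or `(z·w)/θ'` (Euler's trick:
  `θ'` divides `(ya - xb)(ya + xb)`, hence one factor, hence the matching `xa ∓ σyb`); **`inert_peel`**: if `θ'`
  stays prime in `ℤ[η]` (`hprimeE`: `θ' ∣ x² - σy² ⟹ θ' ∣ x, y` — the INERT type) and `θ' ∤ π`, then
  `Nm(z) = π·θ'·μ''` forces `μ'' = θ'·μ'''` and `Nm(z/θ') = π·μ'''`;
* §3 suppliers: Euclid and `hprimeE` for an inert rational prime `q` (`2` a non-square; `7` a non-square mod `q`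
  for `hprimeE`, via gen 47's `aniso_of_no_root`), and `hprimeE` for a degree-one prime with `-t` a non-square.

No named fact, no definition, no `sorry`; nothing about the Hodge conjecture is asserted.
References: [Deligne1982HodgeCycles] §4 p. 30 (1), Cor. 4.2; [Landherr1936HermitianForms]. -/

noncomputable section

set_option linter.dupNamespace false

open Polynomial

namespace Summit.HodgeConjecture.HodgeConjecture.Ring2.WeilCoverageCM

/-! ### §1 Coordinate identities in `ℤ[η] = ℤ[σ] ⊕ ℤ[σ]η` -/

/-- **Brahmagupta composition, conjugate form**: for `z = x + yη`, `w = a + bη` (`x = (A,B)`, `y = (C,D)`,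
`a = (a₀,a₁)`, `b = (b₀,b₁)`), the element `z·w̄ = Q + Pη`, `Q = xa - σyb`, `P = ya - xb`, has
`Nm(z·w̄) = Nm(z)·Nm(w)` (both coordinates). [folklore] -/
theorem nm_conj_mul {A B C D a₀ a₁ b₀ b₁ Q₀ Q₁ P₀ P₁ Xz Yz Xw Yw : ℤ}
    (hQ₀ : Q₀ = A * a₀ - 7 * B * a₁ + 7 * (C * b₁ + D * b₀ - 6 * D * b₁))
    (hQ₁ : Q₁ = A * a₁ + B * a₀ - 6 * B * a₁ - (C * b₀ - 7 * D * b₁) + 6 * (C * b₁ + D * b₀ - 6 * D * b₁))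
    (hP₀ : P₀ = C * a₀ - 7 * D * a₁ - (A * b₀ - 7 * B * b₁))
    (hP₁ : P₁ = C * a₁ + D * a₀ - 6 * D * a₁ - (A * b₁ + B * b₀ - 6 * B * b₁))
    (hXz : A ^ 2 - 7 * B ^ 2 + 14 * C * D - 42 * D ^ 2 = Xz) (hYz : 2 * A * B - 6 * B ^ 2 - C ^ 2 + 12 * C * D - 29 * D ^ 2 = Yz)
    (hXw : a₀ ^ 2 - 7 * a₁ ^ 2 + 14 * b₀ * b₁ - 42 * b₁ ^ 2 = Xw)
    (hYw : 2 * a₀ * a₁ - 6 * a₁ ^ 2 - b₀ ^ 2 + 12 * b₀ * b₁ - 29 * b₁ ^ 2 = Yw) :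
    Q₀ ^ 2 - 7 * Q₁ ^ 2 + 14 * P₀ * P₁ - 42 * P₁ ^ 2 = Xz * Xw - 7 * Yz * Yw ∧
      2 * Q₀ * Q₁ - 6 * Q₁ ^ 2 - P₀ ^ 2 + 12 * P₀ * P₁ - 29 * P₁ ^ 2 = Xz * Yw + Yz * Xw - 6 * Yz * Yw := by
  subst hQ₀ hQ₁ hP₀ hP₁ hXz hYz hXw hYw
  constructor <;> ring

/-- **Brahmagupta composition, direct form**: `z·w = Q' + P'η`, `Q' = xa + σyb`, `P' = ya + xb`,
`Nm(z·w) = Nm(z)·Nm(w)`. [folklore] -/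
theorem nm_mul {A B C D a₀ a₁ b₀ b₁ Q₀ Q₁ P₀ P₁ Xz Yz Xw Yw : ℤ}
    (hQ₀ : Q₀ = A * a₀ - 7 * B * a₁ - 7 * (C * b₁ + D * b₀ - 6 * D * b₁))
    (hQ₁ : Q₁ = A * a₁ + B * a₀ - 6 * B * a₁ + (C * b₀ - 7 * D * b₁) - 6 * (C * b₁ + D * b₀ - 6 * D * b₁))
    (hP₀ : P₀ = C * a₀ - 7 * D * a₁ + (A * b₀ - 7 * B * b₁))
    (hP₁ : P₁ = C * a₁ + D * a₀ - 6 * D * a₁ + (A * b₁ + B * b₀ - 6 * B * b₁))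
    (hXz : A ^ 2 - 7 * B ^ 2 + 14 * C * D - 42 * D ^ 2 = Xz) (hYz : 2 * A * B - 6 * B ^ 2 - C ^ 2 + 12 * C * D - 29 * D ^ 2 = Yz)
    (hXw : a₀ ^ 2 - 7 * a₁ ^ 2 + 14 * b₀ * b₁ - 42 * b₁ ^ 2 = Xw)
    (hYw : 2 * a₀ * a₁ - 6 * a₁ ^ 2 - b₀ ^ 2 + 12 * b₀ * b₁ - 29 * b₁ ^ 2 = Yw) :
    Q₀ ^ 2 - 7 * Q₁ ^ 2 + 14 * P₀ * P₁ - 42 * P₁ ^ 2 = Xz * Xw - 7 * Yz * Yw ∧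
      2 * Q₀ * Q₁ - 6 * Q₁ ^ 2 - P₀ ^ 2 + 12 * P₀ * P₁ - 29 * P₁ ^ 2 = Xz * Yw + Yz * Xw - 6 * Yz * Yw := by
  subst hQ₀ hQ₁ hP₀ hP₁ hXz hYz hXw hYw
  constructor <;> ring

/-- **`(ya - xb)·(ya + xb) = y²·Nm(w) - b²·Nm(z)`** in `ℤ[σ]` (both coordinates; `y² = (C² - 7D², 2CD - 6D²)`,
`b² = (b₀² - 7b₁², 2b₀b₁ - 6b₁²)`). [folklore] -/
theorem pp_prime_identity {A B C D a₀ a₁ b₀ b₁ P₀ P₁ P₀' P₁' Xz Yz Xw Yw : ℤ}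
    (hP₀ : P₀ = C * a₀ - 7 * D * a₁ - (A * b₀ - 7 * B * b₁))
    (hP₁ : P₁ = C * a₁ + D * a₀ - 6 * D * a₁ - (A * b₁ + B * b₀ - 6 * B * b₁))
    (hP₀' : P₀' = C * a₀ - 7 * D * a₁ + (A * b₀ - 7 * B * b₁))
    (hP₁' : P₁' = C * a₁ + D * a₀ - 6 * D * a₁ + (A * b₁ + B * b₀ - 6 * B * b₁))
    (hXz : A ^ 2 - 7 * B ^ 2 + 14 * C * D - 42 * D ^ 2 = Xz) (hYz : 2 * A * B - 6 * B ^ 2 - C ^ 2 + 12 * C * D - 29 * D ^ 2 = Yz)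
    (hXw : a₀ ^ 2 - 7 * a₁ ^ 2 + 14 * b₀ * b₁ - 42 * b₁ ^ 2 = Xw)
    (hYw : 2 * a₀ * a₁ - 6 * a₁ ^ 2 - b₀ ^ 2 + 12 * b₀ * b₁ - 29 * b₁ ^ 2 = Yw) :
    P₀ * P₀' - 7 * P₁ * P₁' =
        ((C ^ 2 - 7 * D ^ 2) * Xw - 7 * (2 * C * D - 6 * D ^ 2) * Yw)
          - ((b₀ ^ 2 - 7 * b₁ ^ 2) * Xz - 7 * (2 * b₀ * b₁ - 6 * b₁ ^ 2) * Yz) ∧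
      P₀ * P₁' + P₁ * P₀' - 6 * P₁ * P₁' =
        ((C ^ 2 - 7 * D ^ 2) * Yw + (2 * C * D - 6 * D ^ 2) * Xw - 6 * (2 * C * D - 6 * D ^ 2) * Yw)
          - ((b₀ ^ 2 - 7 * b₁ ^ 2) * Yz + (2 * b₀ * b₁ - 6 * b₁ ^ 2) * Xz - 6 * (2 * b₀ * b₁ - 6 * b₁ ^ 2) * Yz) := by
  subst hP₀ hP₁ hP₀' hP₁' hXz hYz hXw hYw
  constructor <;> ring

/-- `Nm(θ·z) = θ²·Nm(z)` for `θ = (u', v') ∈ ℤ[σ]`, `θ·z = θx + θyη` (both coordinates;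
`θ² = (u'² - 7v'², 2u'v' - 6v'²)`). [folklore] -/
theorem nm_smul (u' v' q₀ q₁ p₀ p₁ : ℤ) :
    (u' * q₀ - 7 * v' * q₁) ^ 2 - 7 * (u' * q₁ + v' * q₀ - 6 * v' * q₁) ^ 2
        + 14 * (u' * p₀ - 7 * v' * p₁) * (u' * p₁ + v' * p₀ - 6 * v' * p₁)
        - 42 * (u' * p₁ + v' * p₀ - 6 * v' * p₁) ^ 2
      = (u' ^ 2 - 7 * v' ^ 2) * (q₀ ^ 2 - 7 * q₁ ^ 2 + 14 * p₀ * p₁ - 42 * p₁ ^ 2)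
        - 7 * (2 * u' * v' - 6 * v' ^ 2) * (2 * q₀ * q₁ - 6 * q₁ ^ 2 - p₀ ^ 2 + 12 * p₀ * p₁ - 29 * p₁ ^ 2) ∧
    2 * (u' * q₀ - 7 * v' * q₁) * (u' * q₁ + v' * q₀ - 6 * v' * q₁) - 6 * (u' * q₁ + v' * q₀ - 6 * v' * q₁) ^ 2
        - (u' * p₀ - 7 * v' * p₁) ^ 2 + 12 * (u' * p₀ - 7 * v' * p₁) * (u' * p₁ + v' * p₀ - 6 * v' * p₁)
        - 29 * (u' * p₁ + v' * p₀ - 6 * v' * p₁) ^ 2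
      = (u' ^ 2 - 7 * v' ^ 2) * (2 * q₀ * q₁ - 6 * q₁ ^ 2 - p₀ ^ 2 + 12 * p₀ * p₁ - 29 * p₁ ^ 2)
        + (2 * u' * v' - 6 * v' ^ 2) * (q₀ ^ 2 - 7 * q₁ ^ 2 + 14 * p₀ * p₁ - 42 * p₁ ^ 2)
        - 6 * (2 * u' * v' - 6 * v' ^ 2) * (2 * q₀ * q₁ - 6 * q₁ ^ 2 - p₀ ^ 2 + 12 * p₀ * p₁ - 29 * p₁ ^ 2) := by
  constructor <;> ring

/-! ### §2 The two peeling steps for an abstract prime element `θ' = (u', v')` -/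

section Peel

variable {u' v' : ℤ} (hN0 : u' ^ 2 - 6 * u' * v' + 7 * v' ^ 2 ≠ 0)
  (heuclid : ∀ a b c d : ℤ,
    (∃ e f : ℤ, a * c - 7 * b * d = u' * e - 7 * v' * f ∧ a * d + b * c - 6 * b * d = u' * f + v' * e - 6 * v' * f) →
    (∃ e f : ℤ, a = u' * e - 7 * v' * f ∧ b = u' * f + v' * e - 6 * v' * f) ∨
      (∃ e f : ℤ, c = u' * e - 7 * v' * f ∧ d = u' * f + v' * e - 6 * v' * f))
include hN0 heuclid

omit heuclid in
/-- Cancellation of `θ'²`: `θ'²·s = θ'²·s'` ⟹ `s = s'`. [folklore] -/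
theorem zs_sq_mul_left_cancel {c d c' d' : ℤ}
    (h1 : (u' ^ 2 - 7 * v' ^ 2) * c - 7 * (2 * u' * v' - 6 * v' ^ 2) * d
        = (u' ^ 2 - 7 * v' ^ 2) * c' - 7 * (2 * u' * v' - 6 * v' ^ 2) * d')
    (h2 : (u' ^ 2 - 7 * v' ^ 2) * d + (2 * u' * v' - 6 * v' ^ 2) * c - 6 * (2 * u' * v' - 6 * v' ^ 2) * d
        = (u' ^ 2 - 7 * v' ^ 2) * d' + (2 * u' * v' - 6 * v' ^ 2) * c' - 6 * (2 * u' * v' - 6 * v' ^ 2) * d') :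
    c = c' ∧ d = d' := by
  have hN2 : (u' ^ 2 - 7 * v' ^ 2) ^ 2 - 6 * (u' ^ 2 - 7 * v' ^ 2) * (2 * u' * v' - 6 * v' ^ 2)
      + 7 * (2 * u' * v' - 6 * v' ^ 2) ^ 2 ≠ 0 := by
    have e : (u' ^ 2 - 7 * v' ^ 2) ^ 2 - 6 * (u' ^ 2 - 7 * v' ^ 2) * (2 * u' * v' - 6 * v' ^ 2)
        + 7 * (2 * u' * v' - 6 * v' ^ 2) ^ 2 = (u' ^ 2 - 6 * u' * v' + 7 * v' ^ 2) ^ 2 := by ring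
    rw [e]; exact pow_ne_zero 2 hN0
  exact zs_mul_left_cancel hN2 h1 h2

/-- **The split-type peeling step.** `θ' = u' + v'σ` a prime element (Euclid, `N(θ') ≠ 0`); `π = u + vσ`;
`z = (A,B,C,D)` with `Nm(z) = π·θ'·μ''` (`μ'' = M₀ + M₁σ`) and an integral witness `w = (a₀,a₁,b₀,b₁)` with
`Nm(w) = θ'·μ_w` (`μ_w = m₀ + m₁σ`). Then `Nm(z₁) = π·(μ''μ_w)` for an integral `z₁` — namely `(z·w̄)/θ'` or
`(z·w)/θ'`: `θ'` divides `(ya - xb)(ya + xb) = y²Nm(w) - b²Nm(z)`, hence one factor, hence (its square dividing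
`Nm(z)Nm(w) + σ(ya ∓ xb)² = (xa ∓ σyb)²`) also `xa ∓ σyb`. [folklore] -/
theorem split_peel (u v A B C D M₀ M₁ a₀ a₁ b₀ b₁ m₀ m₁ : ℤ)
    (hXz : A ^ 2 - 7 * B ^ 2 + 14 * C * D - 42 * D ^ 2 =
      u * (u' * M₀ - 7 * v' * M₁) - 7 * v * (u' * M₁ + v' * M₀ - 6 * v' * M₁))
    (hYz : 2 * A * B - 6 * B ^ 2 - C ^ 2 + 12 * C * D - 29 * D ^ 2 =
      u * (u' * M₁ + v' * M₀ - 6 * v' * M₁) + v * (u' * M₀ - 7 * v' * M₁) - 6 * v * (u' * M₁ + v' * M₀ - 6 * v' * M₁))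
    (hXw : a₀ ^ 2 - 7 * a₁ ^ 2 + 14 * b₀ * b₁ - 42 * b₁ ^ 2 = u' * m₀ - 7 * v' * m₁)
    (hYw : 2 * a₀ * a₁ - 6 * a₁ ^ 2 - b₀ ^ 2 + 12 * b₀ * b₁ - 29 * b₁ ^ 2 = u' * m₁ + v' * m₀ - 6 * v' * m₁) :
    ∃ A₁ B₁ C₁ D₁ : ℤ,
      A₁ ^ 2 - 7 * B₁ ^ 2 + 14 * C₁ * D₁ - 42 * D₁ ^ 2 =
        u * (M₀ * m₀ - 7 * M₁ * m₁) - 7 * v * (M₀ * m₁ + M₁ * m₀ - 6 * M₁ * m₁) ∧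
      2 * A₁ * B₁ - 6 * B₁ ^ 2 - C₁ ^ 2 + 12 * C₁ * D₁ - 29 * D₁ ^ 2 =
        u * (M₀ * m₁ + M₁ * m₀ - 6 * M₁ * m₁) + v * (M₀ * m₀ - 7 * M₁ * m₁)
          - 6 * v * (M₀ * m₁ + M₁ * m₀ - 6 * M₁ * m₁) := by
  -- names for the coordinates of `z·w̄ = Q + Pη` and `z·w = Q' + P'η`
  obtain ⟨Q₀, hQ₀⟩ : ∃ Q₀ : ℤ, Q₀ = A * a₀ - 7 * B * a₁ + 7 * (C * b₁ + D * b₀ - 6 * D * b₁) := ⟨_, rfl⟩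
  obtain ⟨Q₁, hQ₁⟩ : ∃ Q₁ : ℤ,
    Q₁ = A * a₁ + B * a₀ - 6 * B * a₁ - (C * b₀ - 7 * D * b₁) + 6 * (C * b₁ + D * b₀ - 6 * D * b₁) := ⟨_, rfl⟩
  obtain ⟨P₀, hP₀⟩ : ∃ P₀ : ℤ, P₀ = C * a₀ - 7 * D * a₁ - (A * b₀ - 7 * B * b₁) := ⟨_, rfl⟩
  obtain ⟨P₁, hP₁⟩ : ∃ P₁ : ℤ, P₁ = C * a₁ + D * a₀ - 6 * D * a₁ - (A * b₁ + B * b₀ - 6 * B * b₁) := ⟨_, rfl⟩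
  obtain ⟨Q₀', hQ₀'⟩ : ∃ Q₀' : ℤ, Q₀' = A * a₀ - 7 * B * a₁ - 7 * (C * b₁ + D * b₀ - 6 * D * b₁) := ⟨_, rfl⟩
  obtain ⟨Q₁', hQ₁'⟩ : ∃ Q₁' : ℤ,
    Q₁' = A * a₁ + B * a₀ - 6 * B * a₁ + (C * b₀ - 7 * D * b₁) - 6 * (C * b₁ + D * b₀ - 6 * D * b₁) := ⟨_, rfl⟩
  obtain ⟨P₀', hP₀'⟩ : ∃ P₀' : ℤ, P₀' = C * a₀ - 7 * D * a₁ + (A * b₀ - 7 * B * b₁) := ⟨_, rfl⟩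
  obtain ⟨P₁', hP₁'⟩ : ∃ P₁' : ℤ, P₁' = C * a₁ + D * a₀ - 6 * D * a₁ + (A * b₁ + B * b₀ - 6 * B * b₁) := ⟨_, rfl⟩
  -- the target product `S = π·μ''·μ_w` (coordinates `S₀, S₁`), so that `Nm(z)·Nm(w) = θ'²·S`
  obtain ⟨S₀, hS₀⟩ : ∃ S₀ : ℤ, S₀ = u * (M₀ * m₀ - 7 * M₁ * m₁) - 7 * v * (M₀ * m₁ + M₁ * m₀ - 6 * M₁ * m₁) :=
    ⟨_, rfl⟩
  obtain ⟨S₁, hS₁⟩ : ∃ S₁ : ℤ, S₁ = u * (M₀ * m₁ + M₁ * m₀ - 6 * M₁ * m₁) + v * (M₀ * m₀ - 7 * M₁ * m₁)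
      - 6 * v * (M₀ * m₁ + M₁ * m₀ - 6 * M₁ * m₁) := ⟨_, rfl⟩
  have hNN0 : (u * (u' * M₀ - 7 * v' * M₁) - 7 * v * (u' * M₁ + v' * M₀ - 6 * v' * M₁)) * (u' * m₀ - 7 * v' * m₁)
      - 7 * (u * (u' * M₁ + v' * M₀ - 6 * v' * M₁) + v * (u' * M₀ - 7 * v' * M₁)
          - 6 * v * (u' * M₁ + v' * M₀ - 6 * v' * M₁)) * (u' * m₁ + v' * m₀ - 6 * v' * m₁)
      = (u' ^ 2 - 7 * v' ^ 2) * S₀ - 7 * (2 * u' * v' - 6 * v' ^ 2) * S₁ := by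
    rw [hS₀, hS₁]; ring
  have hNN1 : (u * (u' * M₀ - 7 * v' * M₁) - 7 * v * (u' * M₁ + v' * M₀ - 6 * v' * M₁))
        * (u' * m₁ + v' * m₀ - 6 * v' * m₁)
      + (u * (u' * M₁ + v' * M₀ - 6 * v' * M₁) + v * (u' * M₀ - 7 * v' * M₁)
          - 6 * v * (u' * M₁ + v' * M₀ - 6 * v' * M₁)) * (u' * m₀ - 7 * v' * m₁)
      - 6 * (u * (u' * M₁ + v' * M₀ - 6 * v' * M₁) + v * (u' * M₀ - 7 * v' * M₁)
          - 6 * v * (u' * M₁ + v' * M₀ - 6 * v' * M₁)) * (u' * m₁ + v' * m₀ - 6 * v' * m₁)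
      = (u' ^ 2 - 7 * v' ^ 2) * S₁ + (2 * u' * v' - 6 * v' ^ 2) * S₀ - 6 * (2 * u' * v' - 6 * v' ^ 2) * S₁ := by
    rw [hS₀, hS₁]; ring
  -- `θ' ∣ P·P'`
  have hPP := pp_prime_identity hP₀ hP₁ hP₀' hP₁' hXz hYz hXw hYw
  have hdvd : ∃ e f : ℤ, P₀ * P₀' - 7 * P₁ * P₁' = u' * e - 7 * v' * f ∧
      P₀ * P₁' + P₁ * P₀' - 6 * P₁ * P₁' = u' * f + v' * e - 6 * v' * f := by
    refine ⟨(C ^ 2 - 7 * D ^ 2) * m₀ - 7 * (2 * C * D - 6 * D ^ 2) * m₁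
        - ((b₀ ^ 2 - 7 * b₁ ^ 2) * (u * M₀ - 7 * v * M₁) - 7 * (2 * b₀ * b₁ - 6 * b₁ ^ 2) * (u * M₁ + v * M₀ - 6 * v * M₁)),
      (C ^ 2 - 7 * D ^ 2) * m₁ + (2 * C * D - 6 * D ^ 2) * m₀ - 6 * (2 * C * D - 6 * D ^ 2) * m₁
        - ((b₀ ^ 2 - 7 * b₁ ^ 2) * (u * M₁ + v * M₀ - 6 * v * M₁) + (2 * b₀ * b₁ - 6 * b₁ ^ 2) * (u * M₀ - 7 * v * M₁)
            - 6 * (2 * b₀ * b₁ - 6 * b₁ ^ 2) * (u * M₁ + v * M₀ - 6 * v * M₁)), ?_, ?_⟩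
    · rw [hPP.1]; ring
    · rw [hPP.2]; ring
  -- the common finishing argument, for `(Q, P)` with `θ' ∣ P` and `Nm(Q + Pη) = θ'²·S`
  have finish : ∀ Q₀ Q₁ P₀ P₁ : ℤ,
      (Q₀ ^ 2 - 7 * Q₁ ^ 2 + 14 * P₀ * P₁ - 42 * P₁ ^ 2 = (u' ^ 2 - 7 * v' ^ 2) * S₀ - 7 * (2 * u' * v' - 6 * v' ^ 2) * S₁ ∧
        2 * Q₀ * Q₁ - 6 * Q₁ ^ 2 - P₀ ^ 2 + 12 * P₀ * P₁ - 29 * P₁ ^ 2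
          = (u' ^ 2 - 7 * v' ^ 2) * S₁ + (2 * u' * v' - 6 * v' ^ 2) * S₀ - 6 * (2 * u' * v' - 6 * v' ^ 2) * S₁) →
      (∃ e f : ℤ, P₀ = u' * e - 7 * v' * f ∧ P₁ = u' * f + v' * e - 6 * v' * f) →
      ∃ A₁ B₁ C₁ D₁ : ℤ, A₁ ^ 2 - 7 * B₁ ^ 2 + 14 * C₁ * D₁ - 42 * D₁ ^ 2 = S₀ ∧
        2 * A₁ * B₁ - 6 * B₁ ^ 2 - C₁ ^ 2 + 12 * C₁ * D₁ - 29 * D₁ ^ 2 = S₁ := by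
    intro Q₀ Q₁ P₀ P₁ hNm hP
    obtain ⟨p₀, p₁, hp₀, hp₁⟩ := hP
    -- `Q² = (Q² - σP²) + σP² = θ'²·(S + σp²)` is divisible by `θ'`, hence so is `Q`
    obtain ⟨T₀, hT₀⟩ : ∃ T₀ : ℤ, T₀ = S₀ - 7 * (2 * p₀ * p₁ - 6 * p₁ ^ 2) := ⟨_, rfl⟩
    obtain ⟨T₁, hT₁⟩ : ∃ T₁ : ℤ, T₁ = S₁ + (p₀ ^ 2 - 7 * p₁ ^ 2) - 6 * (2 * p₀ * p₁ - 6 * p₁ ^ 2) := ⟨_, rfl⟩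
    have hQQ : ∃ e f : ℤ, Q₀ * Q₀ - 7 * Q₁ * Q₁ = u' * e - 7 * v' * f ∧
        Q₀ * Q₁ + Q₁ * Q₀ - 6 * Q₁ * Q₁ = u' * f + v' * e - 6 * v' * f := by
      refine ⟨u' * T₀ - 7 * v' * T₁, u' * T₁ + v' * T₀ - 6 * v' * T₁, ?_, ?_⟩
      · rw [hT₀, hT₁]; rw [hp₀, hp₁] at hNm; linear_combination hNm.1
      · rw [hT₀, hT₁]; rw [hp₀, hp₁] at hNm; linear_combination hNm.2
    have hQ : ∃ e f : ℤ, Q₀ = u' * e - 7 * v' * f ∧ Q₁ = u' * f + v' * e - 6 * v' * f := by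
      rcases heuclid Q₀ Q₁ Q₀ Q₁ hQQ with h | h
      · exact h
      · exact h
    obtain ⟨q₀, q₁, hq₀, hq₁⟩ := hQ
    refine ⟨q₀, q₁, p₀, p₁, ?_⟩
    -- `θ'²·Nm(z₁) = Nm(θ'z₁) = Nm(Q + Pη) = θ'²·S`
    have hsm := nm_smul u' v' q₀ q₁ p₀ p₁
    rw [← hq₀, ← hq₁, ← hp₀, ← hp₁] at hsm
    exact zs_sq_mul_left_cancel hN0 (hsm.1.symm.trans hNm.1) (hsm.2.symm.trans hNm.2)
  have key : ∃ A₁ B₁ C₁ D₁ : ℤ, A₁ ^ 2 - 7 * B₁ ^ 2 + 14 * C₁ * D₁ - 42 * D₁ ^ 2 = S₀ ∧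
      2 * A₁ * B₁ - 6 * B₁ ^ 2 - C₁ ^ 2 + 12 * C₁ * D₁ - 29 * D₁ ^ 2 = S₁ := by
    rcases heuclid P₀ P₁ P₀' P₁' hdvd with hP | hP'
    · have hNm := nm_conj_mul hQ₀ hQ₁ hP₀ hP₁ hXz hYz hXw hYw
      exact finish Q₀ Q₁ P₀ P₁ ⟨hNm.1.trans hNN0, hNm.2.trans hNN1⟩ hP
    · have hNm := nm_mul hQ₀' hQ₁' hP₀' hP₁' hXz hYz hXw hYw
      exact finish Q₀' Q₁' P₀' P₁' ⟨hNm.1.trans hNN0, hNm.2.trans hNN1⟩ hP'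
  rw [hS₀, hS₁] at key
  exact key

/-- **The inert-type peeling step.** `θ' = u' + v'σ` a prime element of `ℤ[σ]` (Euclid, `N(θ') ≠ 0`) that stays
prime in `ℤ[η]` — `hprimeE`: `θ' ∣ x² - σy² ⟹ θ' ∣ x ∧ θ' ∣ y` (the place is INERT in `E/F`) — and does not divide
`π = u + vσ` (`hcop`). If `Nm(z) = π·θ'·μ''` then `θ'` divides `z`, `θ'²` divides `Nm(z)`, so `θ' ∣ μ''`, and
`Nm(z/θ') = π·ν` with `μ'' = θ'·ν`. [folklore] -/
theorem inert_peel
    (hprimeE : ∀ A B C D : ℤ,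
      (∃ e f : ℤ, A ^ 2 - 7 * B ^ 2 + 14 * C * D - 42 * D ^ 2 = u' * e - 7 * v' * f ∧
        2 * A * B - 6 * B ^ 2 - C ^ 2 + 12 * C * D - 29 * D ^ 2 = u' * f + v' * e - 6 * v' * f) →
      (∃ e f : ℤ, A = u' * e - 7 * v' * f ∧ B = u' * f + v' * e - 6 * v' * f) ∧
        (∃ e f : ℤ, C = u' * e - 7 * v' * f ∧ D = u' * f + v' * e - 6 * v' * f))
    (u v : ℤ) (hcop : ¬ ∃ e f : ℤ, u = u' * e - 7 * v' * f ∧ v = u' * f + v' * e - 6 * v' * f)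
    (A B C D M₀ M₁ : ℤ)
    (hXz : A ^ 2 - 7 * B ^ 2 + 14 * C * D - 42 * D ^ 2 =
      u * (u' * M₀ - 7 * v' * M₁) - 7 * v * (u' * M₁ + v' * M₀ - 6 * v' * M₁))
    (hYz : 2 * A * B - 6 * B ^ 2 - C ^ 2 + 12 * C * D - 29 * D ^ 2 =
      u * (u' * M₁ + v' * M₀ - 6 * v' * M₁) + v * (u' * M₀ - 7 * v' * M₁) - 6 * v * (u' * M₁ + v' * M₀ - 6 * v' * M₁)) :
    ∃ A₁ B₁ C₁ D₁ N₀ N₁ : ℤ, M₀ = u' * N₀ - 7 * v' * N₁ ∧ M₁ = u' * N₁ + v' * N₀ - 6 * v' * N₁ ∧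
      A₁ ^ 2 - 7 * B₁ ^ 2 + 14 * C₁ * D₁ - 42 * D₁ ^ 2 = u * N₀ - 7 * v * N₁ ∧
      2 * A₁ * B₁ - 6 * B₁ ^ 2 - C₁ ^ 2 + 12 * C₁ * D₁ - 29 * D₁ ^ 2 = u * N₁ + v * N₀ - 6 * v * N₁ := by
  -- `θ' ∣ Nm(z)`: `Nm(z) = θ'·(π·μ'')`
  have hdvd : ∃ e f : ℤ, A ^ 2 - 7 * B ^ 2 + 14 * C * D - 42 * D ^ 2 = u' * e - 7 * v' * f ∧
      2 * A * B - 6 * B ^ 2 - C ^ 2 + 12 * C * D - 29 * D ^ 2 = u' * f + v' * e - 6 * v' * f :=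
    ⟨u * M₀ - 7 * v * M₁, u * M₁ + v * M₀ - 6 * v * M₁, by rw [hXz]; ring, by rw [hYz]; ring⟩
  obtain ⟨⟨q₀, q₁, hq₀, hq₁⟩, ⟨p₀, p₁, hp₀, hp₁⟩⟩ := hprimeE A B C D hdvd
  -- `θ'²·Nm(z₁) = Nm(z) = θ'·(π·μ'')`, so `θ'·Nm(z₁) = π·μ''`
  have hsm := nm_smul u' v' q₀ q₁ p₀ p₁
  rw [← hq₀, ← hq₁, ← hp₀, ← hp₁, hXz, hYz] at hsm
  obtain ⟨X₁, hX₁⟩ : ∃ X₁ : ℤ, X₁ = q₀ ^ 2 - 7 * q₁ ^ 2 + 14 * p₀ * p₁ - 42 * p₁ ^ 2 := ⟨_, rfl⟩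
  obtain ⟨Y₁, hY₁⟩ : ∃ Y₁ : ℤ, Y₁ = 2 * q₀ * q₁ - 6 * q₁ ^ 2 - p₀ ^ 2 + 12 * p₀ * p₁ - 29 * p₁ ^ 2 := ⟨_, rfl⟩
  rw [← hX₁, ← hY₁] at hsm
  -- cancel one `θ'`: `θ'·(θ'·Nm(z₁)) = θ'·(π·μ'')`
  have hc := zs_mul_left_cancel hN0 (c := u' * X₁ - 7 * v' * Y₁) (d := u' * Y₁ + v' * X₁ - 6 * v' * Y₁)
    (c' := u * M₀ - 7 * v * M₁) (d' := u * M₁ + v * M₀ - 6 * v * M₁)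
    (by linear_combination -hsm.1) (by linear_combination -hsm.2)
  -- `θ' ∣ π·μ''`, `θ' ∤ π` ⟹ `θ' ∣ μ''`
  have hdvd2 : ∃ e f : ℤ, u * M₀ - 7 * v * M₁ = u' * e - 7 * v' * f ∧
      u * M₁ + v * M₀ - 6 * v * M₁ = u' * f + v' * e - 6 * v' * f :=
    ⟨X₁, Y₁, hc.1.symm, hc.2.symm⟩
  rcases heuclid u v M₀ M₁ hdvd2 with h | ⟨N₀, N₁, hN₀, hN₁⟩
  · exact absurd h hcop
  refine ⟨q₀, q₁, p₀, p₁, N₀, N₁, hN₀, hN₁, ?_⟩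
  -- cancel again: `θ'·Nm(z₁) = π·θ'·ν = θ'·(π·ν)`
  rw [hN₀, hN₁] at hc
  have hc2 := zs_mul_left_cancel hN0 (c := X₁) (d := Y₁) (c' := u * N₀ - 7 * v * N₁)
    (d' := u * N₁ + v * N₀ - 6 * v * N₁) (by linear_combination hc.1) (by linear_combination hc.2)
  rw [← hX₁, ← hY₁]
  exact hc2

end Peel

/-! ### §3 Suppliers: inert rational primes, and the inert type at a degree-one prime -/

/-- **Euclid's lemma for an inert rational prime** `q` (`2` a non-square mod `q`), as the prime element
`θ' = (q, 0)` of `ℤ[σ]`: `q ∣ xy ⟹ q ∣ x ∨ q ∣ y` (`q ∣ N(x)N(y)`, then part P `zs_inert_dvd`). [folklore] -/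
theorem inertRat_euclid {q : ℕ} (hq : q.Prime) (h2 : ¬ IsSquare (2 : ZMod q)) :
    ∀ a b c d : ℤ,
      (∃ e f : ℤ, a * c - 7 * b * d = (q : ℤ) * e - 7 * 0 * f ∧ a * d + b * c - 6 * b * d = (q : ℤ) * f + 0 * e - 6 * 0 * f) →
      (∃ e f : ℤ, a = (q : ℤ) * e - 7 * 0 * f ∧ b = (q : ℤ) * f + 0 * e - 6 * 0 * f) ∨
        (∃ e f : ℤ, c = (q : ℤ) * e - 7 * 0 * f ∧ d = (q : ℤ) * f + 0 * e - 6 * 0 * f) := by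
  have hqp : Prime (q : ℤ) := Nat.prime_iff_prime_int.1 hq
  intro a b c d ⟨e, f, he1, he2⟩
  have hN : (q : ℤ) ∣ (a ^ 2 - 6 * a * b + 7 * b ^ 2) * (c ^ 2 - 6 * c * d + 7 * d ^ 2) := by
    rw [← zs_norm_mul]
    exact ⟨q * (e ^ 2 - 6 * e * f + 7 * f ^ 2), by rw [he1, he2]; ring⟩
  rcases hqp.dvd_or_dvd hN with h | h
  · obtain ⟨⟨e', he'⟩, ⟨f', hf'⟩⟩ := zs_inert_dvd hq h2 h
    exact Or.inl ⟨e', f', by rw [he']; ring, by rw [hf']; ring⟩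
  · obtain ⟨⟨e', he'⟩, ⟨f', hf'⟩⟩ := zs_inert_dvd hq h2 h
    exact Or.inr ⟨e', f', by rw [he']; ring, by rw [hf']; ring⟩

/-- **An inert rational prime `q` that is inert in `E/F`** (`2` and `7` non-squares mod `q`) stays prime in
`ℤ[η]`: `q ∣ x² - σy² ⟹ q ∣ x ∧ q ∣ y` (gen 47's anisotropy `aniso_of_no_root`; `S² + 6S + 7 = (S+3)² - 2` has no
root). [folklore] -/
theorem inertRat_primeE {q : ℕ} (hq : q.Prime) (h2 : ¬ IsSquare (2 : ZMod q)) (h7 : ¬ IsSquare (7 : ZMod q)) :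
    ∀ A B C D : ℤ,
      (∃ e f : ℤ, A ^ 2 - 7 * B ^ 2 + 14 * C * D - 42 * D ^ 2 = (q : ℤ) * e - 7 * 0 * f ∧
        2 * A * B - 6 * B ^ 2 - C ^ 2 + 12 * C * D - 29 * D ^ 2 = (q : ℤ) * f + 0 * e - 6 * 0 * f) →
      (∃ e f : ℤ, A = (q : ℤ) * e - 7 * 0 * f ∧ B = (q : ℤ) * f + 0 * e - 6 * 0 * f) ∧
        (∃ e f : ℤ, C = (q : ℤ) * e - 7 * 0 * f ∧ D = (q : ℤ) * f + 0 * e - 6 * 0 * f) := by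
  haveI : Fact q.Prime := ⟨hq⟩
  intro A B C D ⟨e, f, he1, he2⟩
  have hnr : ∀ k : ZMod q, k ^ 2 + ((6 : ℤ) : ZMod q) * k + ((7 : ℤ) : ZMod q) ≠ 0 := by
    intro k hk
    push_cast at hk
    exact h2 ⟨k + 3, by linear_combination (-1 : ZMod q) * hk⟩
  have h7' : ∀ r : ZMod q, r ^ 2 ≠ ((7 : ℤ) : ZMod q) := by
    push_cast; exact forall_sq_ne_of_not_isSquare h7
  have key := aniso_of_no_root 6 7 q hq hnr h7' (A : ZMod q) (B : ZMod q) (C : ZMod q) (D : ZMod q)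
    (by
      have := congrArg (Int.cast : ℤ → ZMod q) he1
      push_cast at this
      rw [ZMod.natCast_self] at this
      linear_combination this)
    (by
      have := congrArg (Int.cast : ℤ → ZMod q) he2
      push_cast at this
      rw [ZMod.natCast_self] at this
      linear_combination this)
  obtain ⟨hA, hB, hC, hD⟩ := key
  rw [ZMod.intCast_zmod_eq_zero_iff_dvd] at hA hB hC hD
  obtain ⟨a', ha'⟩ := hA
  obtain ⟨b', hb'⟩ := hB
  obtain ⟨c', hc'⟩ := hC
  obtain ⟨d', hd'⟩ := hD
  exact ⟨⟨a', b', by rw [ha']; ring, by rw [hb']; ring⟩, ⟨c', d', by rw [hc']; ring, by rw [hd']; ring⟩⟩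

/-- **A degree-one prime `π' = u' + v'σ` (norm `ℓ'`, `π'γ' = t' + σ`) with `-t'` a NON-square mod `ℓ'` stays prime
in `ℤ[η]`** (the place is inert in `E = F(√σ)`, `σ ≡ -t'`): `π' ∣ x² - σy² ⟹ π' ∣ x ∧ π' ∣ y`
(`X - t'Y = (A - t'B)² + t'(C - t'D)² + (t'² - 6t' + 7)(…)`, anisotropy). [folklore] -/
theorem degOne_primeE {u' v' g₀ g₁ t' : ℤ} {ℓ' : ℕ} (hℓ' : ℓ'.Prime) (hN' : u' ^ 2 - 6 * u' * v' + 7 * v' ^ 2 = ℓ')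
    (ht' : u' * g₀ - 7 * v' * g₁ = t') (hγ' : v' * g₀ + u' * g₁ - 6 * v' * g₁ = 1)
    (hns : ∀ s : ZMod ℓ', s ^ 2 ≠ -(t' : ZMod ℓ')) :
    ∀ A B C D : ℤ,
      (∃ e f : ℤ, A ^ 2 - 7 * B ^ 2 + 14 * C * D - 42 * D ^ 2 = u' * e - 7 * v' * f ∧
        2 * A * B - 6 * B ^ 2 - C ^ 2 + 12 * C * D - 29 * D ^ 2 = u' * f + v' * e - 6 * v' * f) →
      (∃ e f : ℤ, A = u' * e - 7 * v' * f ∧ B = u' * f + v' * e - 6 * v' * f) ∧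
        (∃ e f : ℤ, C = u' * e - 7 * v' * f ∧ D = u' * f + v' * e - 6 * v' * f) := by
  haveI : Fact ℓ'.Prime := ⟨hℓ'⟩
  intro A B C D h
  have hdvd := (degOne_dvd_iff hN' ht' hγ' _ _).1 h
  have hroot := degOne_root hN' ht' hγ'
  -- `X - t'Y ≡ (A - t'B)² + t'(C - t'D)²`
  have hφ : ((A : ZMod ℓ') - t' * B) ^ 2 + (t' : ZMod ℓ') * ((C : ZMod ℓ') - t' * D) ^ 2 = 0 := by
    have := (ZMod.intCast_zmod_eq_zero_iff_dvd _ ℓ').2 hdvd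
    push_cast at this
    linear_combination this + ((B : ZMod ℓ') ^ 2 - 2 * C * D + ((t' : ZMod ℓ') + 6) * D ^ 2) * hroot
  have sq_zero : ∀ x : ZMod ℓ', x ^ 2 = 0 → x = 0 := fun x hx => pow_eq_zero_iff (n := 2) (by norm_num) |>.1 hx
  have hv : ((C : ZMod ℓ') - t' * D) = 0 := by
    by_contra hv
    refine hns (((A : ZMod ℓ') - t' * B) / ((C : ZMod ℓ') - t' * D)) ?_
    field_simp
    linear_combination hφ
  have hu : ((A : ZMod ℓ') - t' * B) = 0 := by
    refine sq_zero _ ?_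
    linear_combination hφ - (t' : ZMod ℓ') * ((C : ZMod ℓ') - t' * D) * hv
  have hu' : ((A - t' * B : ℤ) : ZMod ℓ') = 0 := by push_cast; exact hu
  have hv' : ((C - t' * D : ℤ) : ZMod ℓ') = 0 := by push_cast; exact hv
  rw [ZMod.intCast_zmod_eq_zero_iff_dvd] at hu' hv'
  exact ⟨(degOne_dvd_iff hN' ht' hγ' _ _).2 hu', (degOne_dvd_iff hN' ht' hγ' _ _).2 hv'⟩


end Summit.HodgeConjecture.HodgeConjecture.Ring2.WeilCoverageCM

end
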